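import Summits.BirchSwinnertonDyer.BirchSwinnertonDyer.Theorems.KolyvaginRankRigidityAtTwoRegularRefillAtRegularStep
import Summits.BirchSwinnertonDyer.BirchSwinnertonDyer.Theorems.KolyvaginRankRigidityAtTwoWalkStepLocal
import Summits.BirchSwinnertonDyer.BirchSwinnertonDyer.Theorems.KolyvaginRankRigidityAtTwoWalkStepRefill
import HarnessLib

/-!
# Crux U1 `KolyvaginBoundedDefectAtTwo` (stmt-BirchSwinnertonDyer-28083), LINE 17 `regular_core_rigidity` v3,
# stub S1b `stub_nearCoreExistenceAtTwo` — ONE STEP OF THE WALK, LOCAL CONSEQUENCES V: the GOOD step (two cutters of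
# opposite signs) leaves no large new class

Width seat `bsd-line-krr2-p2` g14 (ONE READER on S1b); `--supports stmt-BirchSwinnertonDyer-28083` (helper). THEOREMS
ONLY; nothing here proves S1b, U1, a rung or BSD. BSD is NOT proved.

## Setting (g13's, `…RegularRefillAtRegularStep`)
`𝓛 = 𝓕(c)`, a regular place `v ∣ ℓ ∣ c`, `S = H¹_{𝓛[v ↦ Kum_v]}` (previous vertex), `S' = H¹_{𝓛}` (new vertex).
A GOOD step of the walk cuts TWO eigenclasses `p, q ∈ S` of OPPOSITE signs at the same prime, both with large local
order (`2^(k−j₁)`, `2^(k−j₂)`, `j₁, j₂ ≤ j`). Then the local images of the new vertex are small: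
* abstract `two_nsmul_eq_zero_of_apply_eigenGenerators_eq_zero` — in a Lagrangian pair `H_f ⊕ H_tr` with an involution
  whose `H_f`-eigen-subgroups lie in `ℤc₊`, `ℤc₋`: a `t ∈ H_tr` pairing to zero with `c₊` and `c₋` has `2t = 0`;
* **`two_pow_nsmul_localization_eq_zero_of_oppositeCut`** — for every `u ∈ S'`, `2^(j+1) • loc_v u = 0`
  (`loc_v u` pairs to zero with `loc_v p`, `loc_v q` since `X = loc_v(H¹_{𝓛[v ↦ ⊤]})` is isotropic, and
  `2^j c_± ∈ ℤ loc_v p`, `ℤ loc_v q`); hence **`two_pow_nsmul_mem_of_oppositeCut`**: `2^(j+1) • u ∈ S` — the new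
  vertex is the old one up to exponent `2^(j+1)` (no refill of large order), the GOOD-step half of Mazur–Rubin's
  Prop. 4.1.5 mechanism at `p = 2` along regular primes.
References (locators only; no cited FACT is declared): [cite: MazurRubin2004, §4.1, Prop. 4.1.5]
[cite: Jetchev2008, Lemma 5.2] [cite: GrossLMS1991, §3 (3.3)].
Design: no definitions; `K : Type`; axioms `propext`, `Classical.choice`, `Quot.sound`.
-/

set_option autoImplicit false
-- the Theorems namespace of this sub repeats the summit name by design (D-0017 nested layout)
set_option linter.dupNamespace false

noncomputable section

open scoped Classical
open Function NumberField IsDedekindDomain WeierstrassCurve Field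
open Literature.NumberTheory.EllipticCurves Literature.NumberTheory.EllipticCurves.Jetchev2008
open Literature.NumberTheory.GaloisRepresentations Literature.NumberTheory.GaloisCohomology
open Literature.NumberTheory.GaloisRepresentations.DiscreteGaloisModule (localTatePairingZMod tateDual
  transverseSubgroup SelmerStructure)
open Literature.NumberTheory.Automorphic
open Summit.BirchSwinnertonDyer.Rank1Residual
open Summit.BirchSwinnertonDyer.Rank1Residual.JET.RingClassTransverse
open Summit.BirchSwinnertonDyer.Rank1Residual.JET.SelmerVocabulary
open Summit.BirchSwinnertonDyer.Rank1Residual.X11b.Relaxation (invWeilPairing invWeilPairing_apply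
  invWeilPairing_eq_zero_of_mem)
open Summit.BirchSwinnertonDyer.BirchSwinnertonDyer.Theorems.KolyvaginLowerBoundAtTwo
open Summit.BirchSwinnertonDyer.Rank1Residual.JET.Section6 (card_eq_card_inf_ker_mul_card_map card_map_mul_card_map_le)

namespace Summit.BirchSwinnertonDyer.BirchSwinnertonDyer.Theorems.KolyvaginAtTwo.RegularRefill

variable {K : Type} [Field K] [NumberField K] (W : WeierstrassCurve ℚ) [W.IsElliptic] [W.IsGloballyMinimal]
  (k : ℕ)
  (e : geomTorsion (W.baseChange K) ((2 ^ k : ℕ) : ℤ) → geomTorsion (W.baseChange K) ((2 ^ k : ℕ) : ℤ) →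
    AlgebraicClosure K)
  (hμ : ∀ S T, e S T ^ (2 ^ k) = 1)
  (hadd₁ : ∀ S₁ S₂ T, e (S₁ + S₂) T = e S₁ T * e S₂ T)
  (hadd₂ : ∀ S T₁ T₂, e S (T₁ + T₂) = e S T₁ * e S T₂)
  (hgal : ∀ (g : absoluteGaloisGroup K) (S T : geomTorsion (W.baseChange K) ((2 ^ k : ℕ) : ℤ)),
    g • e S T = e (g • S) (g • T))
  (halt : ∀ T, e T T = 1) (hnondeg : ∀ T, (∀ S, e S T = 1) → T = 0)
  (inv : LocalInvariants K (2 ^ k))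
  (hK : IsImaginaryQuadratic K) (hD : NumberField.discr K < -4) (ι : K →+* ℂ)
  [∀ j : ℕ, NumberField (ringClassField K ι j)] (hk : 1 ≤ k)
  (c : ℕ) (hc : Squarefree c)
  (hkol : ∀ ℓ ∈ c.primeFactors, Zhang2014.IsKolyvaginPrime (W.conductorNorm ℤ) W K 2 ℓ)
  (hkM : ∀ ℓ ∈ c.primeFactors, k + 1 ≤ Zhang2014.kolyvaginIndex W 2 ℓ)
  (𝒯 : SelmerStructure ((W.baseChange K).torsionGaloisModule ((2 ^ k : ℕ) : ℤ)))
  (h𝒯 : ∀ v : HeightOneSpectrum (𝓞 K), 𝒯 (Sum.inr v) =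
    ⨅ ℓ ∈ c.primeFactors.filter (fun ℓ : ℕ ↦ ((ℓ : ℕ) : 𝓞 K) ∈ v.asIdeal),
      ⨅ (w' : HeightOneSpectrum (𝓞 (ringClassField K ι ℓ))) (_ : w'.asIdeal.LiesOver v.asIdeal),
        letI := (adicCompletionOfLiesOver K (ringClassField K ι ℓ) v w').toAlgebra
        transverseSubgroup (GaloisRep.toLocal v ((W.baseChange K).torsionGaloisModule ((2 ^ k : ℕ) : ℤ)))
          (w'.adicCompletion (ringClassField K ι ℓ)))
  (hperf : inv.IsPerfect) (hvan : inv.SumLocalTermEqZero) (hcomp : inv.SelmerComplement)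
  {ℓ : ℕ} (hℓc : ℓ ∈ c.primeFactors)
  (hreg : ∃ (v₁ : HeightOneSpectrum (𝓞 ℚ)) (𝔓₁ : Ideal (absIntegers (𝓞 ℚ) ℚ)) (h : absoluteGaloisGroup ℚ),
    (ℓ : 𝓞 ℚ) ∈ v₁.asIdeal ∧ 𝔓₁ ∈ v₁.primesAbove ∧ IsArithFrobAt (𝓞 ℚ) h 𝔓₁ ∧
    (∀ X : geomTorsion W ((2 ^ k : ℕ) : ℤ), h • h • X = X) ∧
    ∃ P : geomTorsion W ((2 ^ k : ℕ) : ℤ), (2 : ℤ) ^ (k - 1) • (P + h • P) ≠ 0)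
  (v : HeightOneSpectrum (𝓞 K)) (hv : (ℓ : 𝓞 K) ∈ v.asIdeal)
  {τ : K ≃ₐ[ℚ] K} (hτ1 : τ ≠ 1) (hfix : τ • v = v) {s : ℤ} (hs : s = 1 ∨ s = -1)

/-! ### §1 Abstract brick -/

section GoodBrick

variable {L : Type*} [AddCommGroup L] {n : ℕ} (b : L →+ L →+ ZMod n)
  (hsymm : ∀ x y, b x y = b y x)
  {Hf Htr : AddSubgroup L} (hcod : Hf ⊔ Htr = ⊤)
  (hHtr : ∀ x ∈ Htr, ∀ y ∈ Htr, b x y = 0)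

include hsymm hcod hHtr in
/-- In a Lagrangian pair with an involution `σ` of `H_f` whose fixed resp. anti-fixed elements lie in `ℤc₊` resp. `ℤc₋`:
a `t ∈ H_tr` pairing to zero with `c₊` and `c₋` has `2t = 0` (`2f = (f + σf) + (f − σf)` pairs to zero with `t` for
every `f ∈ H_f`, so `2t` kills `H_f` and `H_tr`, hence everything). [folklore] -/
theorem two_nsmul_eq_zero_of_apply_eigenGenerators_eq_zero (hinj : Injective b) (σ : L →+ L)
    (hσf : ∀ f ∈ Hf, σ f ∈ Hf) (hσσ : ∀ f ∈ Hf, σ (σ f) = f) {cp cm : L}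
    (hp : ∀ f ∈ Hf, σ f = f → f ∈ AddSubgroup.zmultiples cp)
    (hm : ∀ f ∈ Hf, σ f = -f → f ∈ AddSubgroup.zmultiples cm)
    {t : L} (ht : t ∈ Htr) (htp : b cp t = 0) (htm : b cm t = 0) : 2 • t = 0 := by
  have hzm : ∀ (c : L), b c t = 0 → ∀ x ∈ AddSubgroup.zmultiples c, b x t = 0 := by
    intro c hc x hx
    obtain ⟨a, rfl⟩ := AddSubgroup.mem_zmultiples_iff.mp hx
    rw [map_zsmul, AddMonoidHom.smul_apply, hc, smul_zero]
  have hf : ∀ f ∈ Hf, b f (2 • t) = 0 := fun f hf ↦ by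
    have h1 : b (f + σ f) t = 0 :=
      hzm cp htp _ (hp _ (Hf.add_mem hf (hσf f hf)) (by rw [map_add, hσσ f hf, add_comm]))
    have h2 : b (f - σ f) t = 0 :=
      hzm cm htm _ (hm _ (Hf.sub_mem hf (hσf f hf)) (by rw [map_sub, hσσ f hf, neg_sub]))
    have h3 : b (2 • f) t = 0 := by
      have : 2 • f = (f + σ f) + (f - σ f) := by rw [two_nsmul]; abel
      rw [this, map_add, AddMonoidHom.add_apply, h1, h2, add_zero]
    rw [map_nsmul, ← AddMonoidHom.nsmul_apply, ← map_nsmul]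
    exact h3
  have hall : ∀ x : L, b x (2 • t) = 0 := fun x ↦ by
    have hx : x ∈ Hf ⊔ Htr := by rw [hcod]; exact AddSubgroup.mem_top x
    obtain ⟨f, hf', y, hy, rfl⟩ := AddSubgroup.mem_sup.mp hx
    rw [map_add, AddMonoidHom.add_apply, hf f hf', hHtr y hy _ (Htr.nsmul_mem ht 2), add_zero]
  apply hinj
  ext x
  rw [hsymm, hall, map_zero, AddMonoidHom.zero_apply]

end GoodBrick

/-! ### §2 In situ: a GOOD step leaves no large new class -/

include hμ hadd₁ hadd₂ hgal hK hD hk hc hkol hkM h𝒯 halt hnondeg hperf hvan hℓc hreg hv hτ1 hfix in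
/-- **GOOD STEP: the local images of the new vertex are killed by `2^(j+1)`.** Two eigenclasses `p, q` of the previous
vertex `S = H¹_{𝓛[v ↦ Kum_v]}` with `τ_* p = p`, `τ_* q = −q` and local orders `2^(k−j₁)`, `2^(k−j₂)` (`j₁, j₂ ≤ j ≤ k`)
force `2^(j+1) • loc_v u = 0` for every `u` of the new vertex `S' = H¹_{𝓛}`. [cite: MazurRubin2004, §4.1, Prop. 4.1.5] -/
theorem two_pow_nsmul_localization_eq_zero_of_oppositeCut [NeZero (2 ^ k)]
    [Finite (geomTorsion (W.baseChange K) ((2 ^ k : ℕ) : ℤ))] {j j₁ j₂ : ℕ} (hjk : j ≤ k) (hj₁ : j₁ ≤ j) (hj₂ : j₂ ≤ j)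
    {p q : galoisCohomology ((W.baseChange K).torsionGaloisModule ((2 ^ k : ℕ) : ℤ)) 1}
    (hp : p ∈ SelmerStructure.selmerGroup (Function.update (selmerF W ((2 ^ k : ℕ) : ℤ) 𝒯 (placesDividing K c))
      (Sum.inr v : Place K) ((W.baseChange K).kummerSelmerStructure ((2 ^ k : ℕ) : ℤ) (Sum.inr v : Place K)) :
      SelmerStructure ((W.baseChange K).torsionGaloisModule ((2 ^ k : ℕ) : ℤ))))
    (hq : q ∈ SelmerStructure.selmerGroup (Function.update (selmerF W ((2 ^ k : ℕ) : ℤ) 𝒯 (placesDividing K c))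
      (Sum.inr v : Place K) ((W.baseChange K).kummerSelmerStructure ((2 ^ k : ℕ) : ℤ) (Sum.inr v : Place K)) :
      SelmerStructure ((W.baseChange K).torsionGaloisModule ((2 ^ k : ℕ) : ℤ))))
    (hpτ : conjAct W τ ((2 ^ k : ℕ) : ℤ) p = (1 : ℤ) • p) (hqτ : conjAct W τ ((2 ^ k : ℕ) : ℤ) q = (-1 : ℤ) • q)
    (hpord : addOrderOf (galoisCohomology.localization ((W.baseChange K).torsionGaloisModule ((2 ^ k : ℕ) : ℤ))
      (Sum.inr v : Place K) 1 p) = 2 ^ (k - j₁))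
    (hqord : addOrderOf (galoisCohomology.localization ((W.baseChange K).torsionGaloisModule ((2 ^ k : ℕ) : ℤ))
      (Sum.inr v : Place K) 1 q) = 2 ^ (k - j₂))
    {u : galoisCohomology ((W.baseChange K).torsionGaloisModule ((2 ^ k : ℕ) : ℤ)) 1}
    (hu : u ∈ (selmerF W ((2 ^ k : ℕ) : ℤ) 𝒯 (placesDividing K c)).selmerGroup) :
    (2 ^ (j + 1)) • galoisCohomology.localization ((W.baseChange K).torsionGaloisModule ((2 ^ k : ℕ) : ℤ))
      (Sum.inr v : Place K) 1 u = 0 := by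
  haveI : Finite (galoisCohomology ((((W.baseChange K).torsionGaloisModule ((2 ^ k : ℕ) : ℤ))).toLocal
      (Sum.inr v : Place K)) 1) := finite_galoisCohomology_one_toLocal _ v
  haveI : ∀ w : Place K, CompactSpace (absoluteGaloisGroup (Place.Completion w)) :=
    fun w ↦ absoluteGaloisGroup_compactSpace _
  have hinv : Injective (inv (Sum.inr v)) := (hperf v).1.1
  have hvc : v ∈ placesDividing K c := mem_placesDividing_of_mem_primeFactors hc hℓc v hv
  have hℓ := hkol ℓ hℓc
  have hkℓ : k ≤ Zhang2014.kolyvaginIndex W 2 ℓ := Nat.le_of_succ_le (hkM ℓ hℓc)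
  have hττ : τ * τ = 1 := by
    haveI : Algebra.IsQuadraticExtension ℚ K := ⟨hK.1⟩
    have hcard : Nat.card (K ≃ₐ[ℚ] K) = 2 := by rw [IsGalois.card_aut_eq_finrank, hK.1]
    haveI : Finite (K ≃ₐ[ℚ] K) := Nat.finite_of_card_ne_zero (by rw [hcard]; decide)
    have h : τ ^ Nat.card (K ≃ₐ[ℚ] K) = 1 := pow_card_eq_one'
    rw [hcard, pow_two] at h
    exact h
  obtain ⟨⟨cp, -, hcpord, hlinep⟩, -⟩ :=
    kummer_regular_eigen_at_two W K hK hk hℓ hkℓ hreg v hv hτ1 hfix (s := 1) (Or.inl rfl)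
  obtain ⟨⟨cm, -, hcmord, hlinem⟩, -⟩ :=
    kummer_regular_eigen_at_two W K hK hk hℓ hkℓ hreg v hv hτ1 hfix (s := -1) (Or.inr rfl)
  set 𝓛 := selmerF W ((2 ^ k : ℕ) : ℤ) 𝒯 (placesDividing K c) with h𝓛
  set loc := galoisCohomology.localization ((W.baseChange K).torsionGaloisModule ((2 ^ k : ℕ) : ℤ))
    (Sum.inr v : Place K) 1 with hloc
  set Rel := SelmerStructure.selmerGroup (Function.update 𝓛 (Sum.inr v : Place K) ⊤ :
    SelmerStructure ((W.baseChange K).torsionGaloisModule ((2 ^ k : ℕ) : ℤ))) with hRel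
  set b := invWeilPairing (W.baseChange K) (2 ^ k) e hμ hadd₁ hadd₂ hgal inv (Sum.inr v) with hb
  have hX := isotropic_map_localization_relaxed_selmerF W k e hμ hadd₁ hadd₂ hgal halt hnondeg inv hK hD ι hk c hc hkol
    hkM 𝒯 h𝒯 hperf hvan v hvc
  -- `loc p ∈ X ∩ ℤc₊`, `loc q ∈ X ∩ ℤc₋`, `loc u ∈ X ∩ 𝒯_v`
  have hmemX : ∀ {z : galoisCohomology ((W.baseChange K).torsionGaloisModule ((2 ^ k : ℕ) : ℤ)) 1} {s : ℤ},
      z ∈ SelmerStructure.selmerGroup (Function.update 𝓛 (Sum.inr v : Place K)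
        ((W.baseChange K).kummerSelmerStructure ((2 ^ k : ℕ) : ℤ) (Sum.inr v : Place K)) :
        SelmerStructure ((W.baseChange K).torsionGaloisModule ((2 ^ k : ℕ) : ℤ))) →
      conjAct W τ ((2 ^ k : ℕ) : ℤ) z = s • z →
      loc z ∈ Rel.map loc ∧ loc z ∈ (W.baseChange K).kummerSelmerStructure ((2 ^ k : ℕ) : ℤ) (Sum.inr v) ⊓
        (conjActPlace W τ ((2 ^ k : ℕ) : ℤ) hfix - s • AddMonoidHom.id _).ker := by
    intro z s hz hzτ
    rw [selmerGroup_update_eq_inf_comap W k _ v] at hz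
    obtain ⟨hzRel, hzKum⟩ := AddSubgroup.mem_inf.mp hz
    refine ⟨AddSubgroup.mem_map.mpr ⟨z, hzRel, rfl⟩, AddSubgroup.mem_inf.mpr ⟨AddSubgroup.mem_comap.mp hzKum,
      (AddMonoidHom.mem_ker).mpr ?_⟩⟩
    rw [AddMonoidHom.sub_apply, AddMonoidHom.smul_apply, AddMonoidHom.id_apply, sub_eq_zero, hloc,
      conjActPlace_localization, hzτ, map_zsmul]
  obtain ⟨hpX, hpeig⟩ := hmemX hp hpτ
  obtain ⟨hqX, hqeig⟩ := hmemX hq hqτ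
  have h𝓛v : 𝓛 (Sum.inr v) = 𝒯 (Sum.inr v) := by rw [h𝓛, selmerF_inr, if_pos hvc]
  have hS' : 𝓛.selmerGroup = Rel ⊓ (𝒯 (Sum.inr v)).comap loc := by
    have h := selmerGroup_update_eq_inf_comap W k 𝓛 v (𝒯 (Sum.inr v))
    have hupd : Function.update 𝓛 (Sum.inr v : Place K) (𝒯 (Sum.inr v)) = 𝓛 := by
      rw [← h𝓛v, Function.update_eq_self]
    rw [hupd] at h
    exact h
  rw [hS'] at hu
  have huX : loc u ∈ Rel.map loc := AddSubgroup.mem_map.mpr ⟨u, (AddSubgroup.mem_inf.mp hu).1, rfl⟩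
  have huT : loc u ∈ 𝒯 (Sum.inr v) := AddSubgroup.mem_comap.mp (AddSubgroup.mem_inf.mp hu).2
  -- `2^j c₊ ∈ ℤ loc p`, `2^j c₋ ∈ ℤ loc q`
  have hgenp : (2 ^ j) • cp ∈ AddSubgroup.zmultiples (loc p) := by
    have h := two_pow_nsmul_mem_zmultiples_of_addOrderOf hcpord ((hlinep _).mp hpeig) (hj₁.trans hjk) hpord
    rw [← Nat.sub_add_cancel hj₁, pow_add, mul_comm, mul_nsmul]
    exact AddSubgroup.nsmul_mem _ h _
  have hgenq : (2 ^ j) • cm ∈ AddSubgroup.zmultiples (loc q) := by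
    have h := two_pow_nsmul_mem_zmultiples_of_addOrderOf hcmord ((hlinem _).mp hqeig) (hj₂.trans hjk) hqord
    rw [← Nat.sub_add_cancel hj₂, pow_add, mul_comm, mul_nsmul]
    exact AddSubgroup.nsmul_mem _ h _
  -- `⟨c₊, 2^j t⟩ = 0 = ⟨c₋, 2^j t⟩` for `t = loc u`
  have hkill : ∀ {c₁ z : galoisCohomology ((((W.baseChange K).torsionGaloisModule ((2 ^ k : ℕ) : ℤ))).toLocal
      (Sum.inr v : Place K)) 1}, z ∈ Rel.map loc → (2 ^ j) • c₁ ∈ AddSubgroup.zmultiples z →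
      b c₁ ((2 ^ j) • loc u) = 0 := by
    intro c₁ z hzX hc₁
    obtain ⟨a, ha⟩ := AddSubgroup.mem_zmultiples_iff.mp hc₁
    rw [map_nsmul, ← AddMonoidHom.nsmul_apply, ← map_nsmul, ← ha, map_zsmul, AddMonoidHom.smul_apply,
      hX _ hzX _ huX, smul_zero]
  have h2 := two_nsmul_eq_zero_of_apply_eigenGenerators_eq_zero b
    (fun x y ↦ AdditiveKoly.LagrangianSwitchAtP.invWeilPairing_symm (W.baseChange K) (2 ^ k) e hμ hadd₁ hadd₂ hgal
      halt inv (Sum.inr v) x y)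
    (kummer_sup_transverse_eq_top_two W k hK hD ι hk c hc hkol hkM 𝒯 h𝒯 v hvc)
    (fun x hx y hy ↦ transverse_isotropic_two W k e hμ hadd₁ hadd₂ hgal halt hnondeg inv hK hD ι hk c hc hkol hkM 𝒯
      h𝒯 hperf v hvc hx hy)
    (invWeilPairing_injective_of_symm W k e hμ hadd₁ hadd₂ hgal halt hnondeg inv v hinv)
    (conjActPlace W τ ((2 ^ k : ℕ) : ℤ) hfix)
    (fun f hf ↦ conjActPlace_mem_kummerSelmerStructure W τ ((2 ^ k : ℕ) : ℤ) hfix hf)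
    (fun f _ ↦ conjActPlace_conjActPlace W τ ((2 ^ k : ℕ) : ℤ) hττ hfix hfix f)
    (fun f hf hσf ↦ (hlinep f).mp (AddSubgroup.mem_inf.mpr ⟨hf, (AddMonoidHom.mem_ker).mpr (by
      rw [AddMonoidHom.sub_apply, AddMonoidHom.smul_apply, AddMonoidHom.id_apply, hσf, one_zsmul, sub_self])⟩))
    (fun f hf hσf ↦ (hlinem f).mp (AddSubgroup.mem_inf.mpr ⟨hf, (AddMonoidHom.mem_ker).mpr (by
      rw [AddMonoidHom.sub_apply, AddMonoidHom.smul_apply, AddMonoidHom.id_apply, hσf, neg_one_zsmul, sub_self])⟩))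
    (AddSubgroup.nsmul_mem _ huT _) (hkill hpX hgenp) (hkill hqX hgenq)
  rw [pow_succ, mul_nsmul]
  exact h2

include hμ hadd₁ hadd₂ hgal hK hD hk hc hkol hkM h𝒯 halt hnondeg hperf hvan hℓc hreg hv hτ1 hfix in
/-- **GOOD STEP: `2^(j+1) · H¹_{𝓛} ⊆ H¹_{𝓛[v ↦ Kum_v]}`** — every class of the new vertex, multiplied by `2^(j+1)`, has
`loc_v = 0` and therefore lies in the previous vertex (`mem_update_kummer_of_localization_eq_zero`, p686806).
[cite: MazurRubin2004, §4.1, Prop. 4.1.5] -/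
theorem two_pow_nsmul_mem_of_oppositeCut [NeZero (2 ^ k)]
    [Finite (geomTorsion (W.baseChange K) ((2 ^ k : ℕ) : ℤ))] {j j₁ j₂ : ℕ} (hjk : j ≤ k) (hj₁ : j₁ ≤ j) (hj₂ : j₂ ≤ j)
    {p q : galoisCohomology ((W.baseChange K).torsionGaloisModule ((2 ^ k : ℕ) : ℤ)) 1}
    (hp : p ∈ SelmerStructure.selmerGroup (Function.update (selmerF W ((2 ^ k : ℕ) : ℤ) 𝒯 (placesDividing K c))
      (Sum.inr v : Place K) ((W.baseChange K).kummerSelmerStructure ((2 ^ k : ℕ) : ℤ) (Sum.inr v : Place K)) :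
      SelmerStructure ((W.baseChange K).torsionGaloisModule ((2 ^ k : ℕ) : ℤ))))
    (hq : q ∈ SelmerStructure.selmerGroup (Function.update (selmerF W ((2 ^ k : ℕ) : ℤ) 𝒯 (placesDividing K c))
      (Sum.inr v : Place K) ((W.baseChange K).kummerSelmerStructure ((2 ^ k : ℕ) : ℤ) (Sum.inr v : Place K)) :
      SelmerStructure ((W.baseChange K).torsionGaloisModule ((2 ^ k : ℕ) : ℤ))))
    (hpτ : conjAct W τ ((2 ^ k : ℕ) : ℤ) p = (1 : ℤ) • p) (hqτ : conjAct W τ ((2 ^ k : ℕ) : ℤ) q = (-1 : ℤ) • q)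
    (hpord : addOrderOf (galoisCohomology.localization ((W.baseChange K).torsionGaloisModule ((2 ^ k : ℕ) : ℤ))
      (Sum.inr v : Place K) 1 p) = 2 ^ (k - j₁))
    (hqord : addOrderOf (galoisCohomology.localization ((W.baseChange K).torsionGaloisModule ((2 ^ k : ℕ) : ℤ))
      (Sum.inr v : Place K) 1 q) = 2 ^ (k - j₂))
    {u : galoisCohomology ((W.baseChange K).torsionGaloisModule ((2 ^ k : ℕ) : ℤ)) 1}
    (hu : u ∈ (selmerF W ((2 ^ k : ℕ) : ℤ) 𝒯 (placesDividing K c)).selmerGroup) :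
    (2 ^ (j + 1)) • u ∈ SelmerStructure.selmerGroup (Function.update (selmerF W ((2 ^ k : ℕ) : ℤ) 𝒯
      (placesDividing K c)) (Sum.inr v : Place K) ((W.baseChange K).kummerSelmerStructure ((2 ^ k : ℕ) : ℤ)
      (Sum.inr v : Place K)) : SelmerStructure ((W.baseChange K).torsionGaloisModule ((2 ^ k : ℕ) : ℤ))) :=
  mem_update_kummer_of_localization_eq_zero W k c 𝒯 v (mem_placesDividing_of_mem_primeFactors hc hℓc v hv)
    (AddSubgroup.nsmul_mem _ hu _) (by
      rw [map_nsmul]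
      exact two_pow_nsmul_localization_eq_zero_of_oppositeCut W k e hμ hadd₁ hadd₂ hgal halt hnondeg inv hK hD ι hk c
        hc hkol hkM 𝒯 h𝒯 hperf hvan hℓc hreg v hv hτ1 hfix hjk hj₁ hj₂ hp hq hpτ hqτ hpord hqord hu)

end Summit.BirchSwinnertonDyer.BirchSwinnertonDyer.Theorems.KolyvaginAtTwo.RegularRefill

end
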